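import Summits.CriticalPhenomena.PercolationContinuityZ3.Theorems.PercNearOneGluingNoHeavyLowerTailSahiMixtureGenericCellThree
import Summits.CriticalPhenomena.PercolationContinuityZ3.Theorems.PercNearOneGluingNoHeavyLowerTailSahiMixtureIrredundant
import Summits.CriticalPhenomena.PercolationContinuityZ3.Theorems.PercNearOneGluingNoHeavyLowerTailSahiMixtureTop

/-!
# H-MIX for FOUR events reduces to two named cells: the generic three-slot cell GC(3) and "OR into three of four" over the hereditary class

Support file of the one-cut programme (crux `NoHeavyLowerTail`, stmt-CriticalPhenomena-4575; cell `prim-masterthm`, seat P3, gen 6;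
`run/shared/lean/prim/prim-masterthm/prim-masterthm-p3/HIERARCHY.md` §13 UPDATE 2).  Assembles the irredundant reduction (`…SahiMixtureIrredundant`), the generic
three-slot cell (`…SahiMixtureGenericCellThree`), the hereditary (4,2) cell (`…SahiMixtureHereditary`) and TOP(4) (`…SahiMixtureTop`) into:

**`hereditaryMixture_four_of_cells`** — `GenericCellThree → OrThreeOfFourCell →` the hereditary mixture statement for every probability weight, every hereditarily
all-orders-positive quadruple `A : Fin 4 → Set α`, every `F` and EVERY row of the ∩-closed family of the OR-mixed events (all multisets of all `2^4` members).
Here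
* `GenericCellThree` (GC(3), typed): for events `P_j ⊆ Q_j` (j < 3) whose six-member family is hereditarily all-orders positive, the cell
  `h ↦ E_3(μ⊗coin(h); mixEv P_j Q_j)` is Bernstein-positive of degree 3 (its co-monotone case is the theorem `bernsteinPos_three_mixEv_of_comonotone`;
  certificate search: ttrl cp-mix l.976, kit j099844);
* `OrThreeOfFourCell` (typed): OR-ing the coin into `A_0, A_1, A_2` of a hereditarily all-orders-positive quadruple is Bernstein-positive of degree 4 (over `K_4`
  this is ttrl cp-mix's degree-5/6 certificate, MIXCOMB §7.3; a hereditary-row form is requested, l.976).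
The proof: uncovered cells only (`bernsteinPos_sahiE_of_uncovered`); uncovered ⇒ irredundant ⇒ `m ≤ 4`; `m = 4` forces SINGLETON index sets
(`Irredundant.exists_perm_singleton`), i.e. the original cells, dispatched on `|F|` after sorting `F` by a permutation (`|F| = 0`: constant; `1`:
`(1−h)E_4 + 2hE_3`; `2`: the hereditary cell; `3`: the hypothesis; `4`: TOP(4)); `m = 3`: an instance of GC(3) (`biInter_orCoin_eq_mixEv`); `m = 2`: explicit
(`bernsteinPos_two_mixEv`: `c = (Cov P, Cov P + Cov Q + d_0d_1, Cov Q)`); `m ≤ 1`: immediate.  HONEST FRAMING: a reduction to two open, finite, numerically clean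
cells; H-MIX(4) itself is not claimed. [this work]
-/

noncomputable section

open scoped Classical

namespace Summit.CriticalPhenomena.PercolationContinuityZ3.Theorems

open Finset Function
open Literature.Combinatorics.Sahi2008
open Literature.Probability.Percolation.BHK2006 (ind_le_one)
open Literature.Probability.Percolation.DecisionTree (ind ind_of_mem ind_of_not_mem ind_nonneg)

namespace SahiMixture

/-! ### The two open cells, typed -/

/-- **GC(3)** — the generic three-slot cell conjecture (HIERARCHY §13 UPDATE 2 (n)): for a probability weight and events `P_j ⊆ Q_j`, `j < 3`, whose six-member
family is hereditarily all-orders positive, `h ↦ E_3(μ⊗coin(h); mixEv P_0 Q_0, mixEv P_1 Q_1, mixEv P_2 Q_2)` is Bernstein-positive of degree `3`.  Co-monotone case: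
theorem (`bernsteinPos_three_mixEv_of_comonotone`); general case OPEN (certificate search running).  Never a fact: use as a hypothesis. [status: open] -/
@[conjecture] def GenericCellThree : Prop :=
  ∀ (α : Type) [Fintype α] (μ : α → ℝ), (∀ a, 0 ≤ μ a) → ∑ a, μ a = 1 →
    ∀ (P0 P1 P2 Q0 Q1 Q2 : Set α), P0 ⊆ Q0 → P1 ⊆ Q1 → P2 ⊆ Q2 → HereditaryAllOrders μ ![P0, P1, P2, Q0, Q1, Q2] →
      BernsteinPos 3 (fun h => sahiE (coinWeight μ h) 3 ![ind (mixEv P0 Q0), ind (mixEv P1 Q1), ind (mixEv P2 Q2)])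

/-- **OR into three of four members over the hereditary class** (HIERARCHY §13 UPDATE 2 (m)): for a hereditarily all-orders-positive quadruple,
`h ↦ E_4(A_0∪H, A_1∪H, A_2∪H, A_3)` is Bernstein-positive of degree `4`.  TRUE over the larger class `K_4` by ttrl cp-mix's exact degree-5/6 certificates
(MIXCOMB §7.3, not replayed in Lean); a short hereditary-row form is requested.  Never a fact: use as a hypothesis. [status: open] -/
@[conjecture] def OrThreeOfFourCell : Prop :=
  ∀ (α : Type) [Fintype α] (μ : α → ℝ), (∀ a, 0 ≤ μ a) → ∑ a, μ a = 1 →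
    ∀ (A : Fin 4 → Set α), HereditaryAllOrders μ A →
      BernsteinPos 4 (fun h => sahiE (coinWeight μ h) 4
        ![ind (orCoin (A 0) true), ind (orCoin (A 1) true), ind (orCoin (A 2) true), ind (orCoin (A 3) false)])

/-! ### Plumbing: derived families, singleton index sets, sorting a Boolean vector -/

section Plumbing

variable {α : Type*} [Fintype α] {μ : α → ℝ} {n : ℕ} {A : Fin n → Set α}

/-- Derived families (members `⋂_{i∈G l} A_i`) of a hereditarily all-orders-positive family are hereditarily all-orders positive. [this work] -/
theorem HereditaryAllOrders.comp (hA : HereditaryAllOrders μ A) {k : ℕ} (G : Fin k → Finset (Fin n)) :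
    HereditaryAllOrders μ (fun l => ⋂ i ∈ G l, A i) := by
  intro m K
  have e : (fun j => ind (⋂ l ∈ K j, ⋂ i ∈ G l, A i)) = fun j => ind (⋂ i ∈ (K j).biUnion G, A i) := by
    funext j; rw [Finset.set_biInter_biUnion]
  rw [e]; exact hA m (fun j => (K j).biUnion G)

/-- An irredundant family of `n` index sets in `Fin n` consists of singletons, one for each element: `K j = {σ j}` for a permutation `σ`. [this work] -/
theorem Irredundant.exists_perm_singleton {K : Fin n → Finset (Fin n)} (h : Irredundant K) :
    ∃ σ : Equiv.Perm (Fin n), ∀ j, K j = {σ j} := by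
  have hex : ∀ a : Fin n, ∃ i : Fin n, i ∈ K a ∧ i ∉ ((univ : Finset (Fin n)).erase a).biUnion K := fun a => by
    simpa [Finset.subset_iff] using h a
  choose f hf using hex
  have hinj : Injective f := by
    intro a b hab
    by_contra hne
    have : f a ∈ ((univ : Finset (Fin n)).erase a).biUnion K :=
      Finset.mem_biUnion.2 ⟨b, Finset.mem_erase.2 ⟨Ne.symm hne, Finset.mem_univ b⟩, hab ▸ (hf b).1⟩
    exact (hf a).2 this
  have hbij : Bijective f := (Fintype.bijective_iff_injective_and_card f).2 ⟨hinj, rfl⟩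
  refine ⟨Equiv.ofBijective f hbij, fun j => ?_⟩
  ext i
  simp only [Equiv.ofBijective_apply, Finset.mem_singleton]
  constructor
  · intro hi
    obtain ⟨l, rfl⟩ := hbij.2 i
    by_contra hne
    have hjl : j ≠ l := fun h => hne (by rw [h])
    exact (hf l).2 (Finset.mem_biUnion.2 ⟨j, Finset.mem_erase.2 ⟨hjl, Finset.mem_univ j⟩, hi⟩)
  · rintro rfl; exact (hf j).1

/-- Every Boolean vector on `Fin 4` is a permutation of a "trues first" vector `i ↦ [i < k]`. [folklore] -/
theorem exists_perm_sorted_bool_four (F : Fin 4 → Bool) :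
    ∃ (τ : Equiv.Perm (Fin 4)) (k : Fin 5), (fun i => F (τ i)) = fun i => decide (i.val < k.val) := by
  revert F
  decide

end Plumbing

/-! ### The easy cells: two slots; OR into none / one of four -/

section EasyCells

variable {α : Type*} [Fintype α] {μ : α → ℝ} (hμ : ∀ a, 0 ≤ μ a) (hμ1 : ∑ a, μ a = 1)

/-- **The generic two-slot cell**: `E_2 = (1−h)²Cov(P_0,P_1) + h(1−h)[Cov P + Cov Q + (q_0−p_0)(q_1−p_1)] + h²Cov(Q_0,Q_1)`. [this work] -/
theorem sahiE_two_mixEv_eq (P0 P1 Q0 Q1 : Set α) (h : ℝ) :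
    sahiE (coinWeight μ h) 2 ![ind (mixEv P0 Q0), ind (mixEv P1 Q1)]
      = (1 - h) ^ 2 * (ex μ (ind P0 * ind P1) - ex μ (ind P0) * ex μ (ind P1))
        + h * (1 - h) * ((ex μ (ind P0 * ind P1) - ex μ (ind P0) * ex μ (ind P1)) + (ex μ (ind Q0 * ind Q1) - ex μ (ind Q0) * ex μ (ind Q1))
            + (ex μ (ind Q0) - ex μ (ind P0)) * (ex μ (ind Q1) - ex μ (ind P1)))
        + h ^ 2 * (ex μ (ind Q0 * ind Q1) - ex μ (ind Q0) * ex μ (ind Q1)) := by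
  rw [sahiE_two]
  simp only [exm₂, exm₁]
  ring

include hμ in
/-- The generic two-slot cell is Bernstein-positive whenever `P_j ⊆ Q_j` and both covariances are nonnegative (ALWAYS the case on the hereditary class). [this work] -/
theorem bernsteinPos_two_mixEv (P0 P1 Q0 Q1 : Set α) (h0 : P0 ⊆ Q0) (h1 : P1 ⊆ Q1)
    (hP : 0 ≤ ex μ (ind P0 * ind P1) - ex μ (ind P0) * ex μ (ind P1)) (hQ : 0 ≤ ex μ (ind Q0 * ind Q1) - ex μ (ind Q0) * ex μ (ind Q1)) :
    BernsteinPos 2 (fun h => sahiE (coinWeight μ h) 2 ![ind (mixEv P0 Q0), ind (mixEv P1 Q1)]) := by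
  have d0 : 0 ≤ ex μ (ind Q0) - ex μ (ind P0) :=
    sub_nonneg.2 (ex_mono hμ fun a => by
      by_cases ha : a ∈ P0
      · rw [ind_of_mem ha, ind_of_mem (h0 ha)]
      · rw [ind_of_not_mem ha]; exact ind_nonneg _ _)
  have d1 : 0 ≤ ex μ (ind Q1) - ex μ (ind P1) :=
    sub_nonneg.2 (ex_mono hμ fun a => by
      by_cases ha : a ∈ P1
      · rw [ind_of_mem ha, ind_of_mem (h1 ha)]
      · rw [ind_of_not_mem ha]; exact ind_nonneg _ _)
  have hmid : 0 ≤ (ex μ (ind P0 * ind P1) - ex μ (ind P0) * ex μ (ind P1)) + (ex μ (ind Q0 * ind Q1) - ex μ (ind Q0) * ex μ (ind Q1))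
      + (ex μ (ind Q0) - ex μ (ind P0)) * (ex μ (ind Q1) - ex μ (ind P1)) := by positivity
  refine (((bp_g2.smul hP).add (bp_hg.smul hmid)).add (bp_h2.smul hQ)).congr fun h _ _ => ?_
  rw [sahiE_two_mixEv_eq]; ring

include hμ1 in
/-- OR-ing the coin into NO member: the cell is the constant `E_4(A)`. [this work] -/
theorem sahiE_four_orCoin_none_eq (A0 A1 A2 A3 : Set α) (h : ℝ) :
    sahiE (coinWeight μ h) 4 ![ind (orCoin A0 false), ind (orCoin A1 false), ind (orCoin A2 false), ind (orCoin A3 false)]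
      = sahiE μ 4 ![ind A0, ind A1, ind A2, ind A3] := by
  rw [sahiE_four, sahiE_four]
  simp only [exc_or₄, exc_or₃, exc_or₂, exc_or₁ μ h hμ1, cond_false]
  ring

include hμ1 in
/-- **OR-ing the coin into ONE member**: `E_4(A_0∪H, A_1, A_2, A_3) = (1−h)·E_4(A) + 2h·E_3(A_1,A_2,A_3)`. [this work] -/
theorem sahiE_four_orCoin_one_eq (A0 A1 A2 A3 : Set α) (h : ℝ) :
    sahiE (coinWeight μ h) 4 ![ind (orCoin A0 true), ind (orCoin A1 false), ind (orCoin A2 false), ind (orCoin A3 false)]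
      = (1 - h) * sahiE μ 4 ![ind A0, ind A1, ind A2, ind A3] + 2 * h * sahiE μ 3 ![ind A1, ind A2, ind A3] := by
  rw [sahiE_four, sahiE_four, sahiE_three]
  simp only [exc_or₄, exc_or₃, exc_or₂, exc_or₁ μ h hμ1, cond_true, cond_false, one_mul]
  ring

/-- The one-member cell is Bernstein-positive as soon as `E_4(A) ≥ 0` and `E_3(A_1,A_2,A_3) ≥ 0`. [this work] -/
theorem bernsteinPos_four_orCoin_one (A0 A1 A2 A3 : Set α) (hμ1 : ∑ a, μ a = 1) (hE4 : 0 ≤ sahiE μ 4 ![ind A0, ind A1, ind A2, ind A3])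
    (hE3 : 0 ≤ sahiE μ 3 ![ind A1, ind A2, ind A3]) :
    BernsteinPos 4 (fun h => sahiE (coinWeight μ h) 4
      ![ind (orCoin A0 true), ind (orCoin A1 false), ind (orCoin A2 false), ind (orCoin A3 false)]) :=
  ((bernsteinPos_affine hE4 (mul_nonneg zero_le_two hE3)).mono (by norm_num : 1 ≤ 4)).congr fun h _ _ => by
    rw [sahiE_four_orCoin_one_eq hμ1]; ring

end EasyCells

/-! ### The singleton cells of four events, all sixteen `F` -/

section Singletons

variable {α : Type} [Fintype α] {μ : α → ℝ} (hμ : ∀ a, 0 ≤ μ a) (hμ1 : ∑ a, μ a = 1)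
include hμ hμ1

/-- The singleton cells `E_4(A_i ∪ [F i]·H)` for a "trues first" flag vector `F = [· < k]`. [this work] -/
theorem bernsteinPos_four_singletons_sorted (h3 : OrThreeOfFourCell) (A : Fin 4 → Set α) (hA : HereditaryAllOrders μ A) (k : Fin 5) :
    BernsteinPos 4 (fun h => sahiE (coinWeight μ h) 4 (fun i => ind (orCoin (A i) (decide (i.val < k.val))))) := by
  have hall : AllOrders μ A := hA.allOrders
  have hE4 : 0 ≤ sahiE μ 4 ![ind (A 0), ind (A 1), ind (A 2), ind (A 3)] := by
    have e : (fun j : Fin 4 => ind (A (id j))) = ![ind (A 0), ind (A 1), ind (A 2), ind (A 3)] := funext fun j => by fin_cases j <;> rfl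
    rw [← e]; exact hall 4 id
  have hE3 : 0 ≤ sahiE μ 3 ![ind (A 1), ind (A 2), ind (A 3)] := by
    have e : (fun j : Fin 3 => ind (A (Fin.succ j))) = ![ind (A 1), ind (A 2), ind (A 3)] := funext fun j => by fin_cases j <;> rfl
    rw [← e]; exact hall 3 Fin.succ
  fin_cases k
  · -- k = 0: no member mixed
    refine (bernsteinPos_const 4 hE4).congr fun h _ _ => ?_
    rw [← sahiE_four_orCoin_none_eq hμ1 (A 0) (A 1) (A 2) (A 3) h]
    congr 1; funext i; fin_cases i <;> rfl
  · -- k = 1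
    refine (bernsteinPos_four_orCoin_one (A 0) (A 1) (A 2) (A 3) hμ1 hE4 hE3).congr fun h _ _ => ?_
    congr 1; funext i; fin_cases i <;> rfl
  · -- k = 2: the hereditary cell
    refine (bernsteinPos_four_orCoin_two_of_hereditaryAllOrders hμ hμ1 A hA).congr fun h _ _ => ?_
    congr 1; funext i; fin_cases i <;> rfl
  · -- k = 3: the hypothesis
    refine (h3 α μ hμ hμ1 A hA).congr fun h _ _ => ?_
    congr 1; funext i; fin_cases i <;> rfl
  · -- k = 4: TOP(4)
    refine (bernsteinPos_four_orCoin_top hμ hμ1 (A 0) (A 1) (A 2) (A 3) hE4).congr fun h _ _ => ?_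
    congr 1; funext i; fin_cases i <;> rfl

/-- **All sixteen singleton cells of a hereditary quadruple**, assuming `OrThreeOfFourCell` (sort `F` by a permutation; `E_4` is symmetric). [this work] -/
theorem bernsteinPos_four_singletons (h3 : OrThreeOfFourCell) (A : Fin 4 → Set α) (hA : HereditaryAllOrders μ A) (F : Fin 4 → Bool) :
    BernsteinPos 4 (fun h => sahiE (coinWeight μ h) 4 (fun i => ind (orCoin (A i) (F i)))) := by
  obtain ⟨τ, k, hk⟩ := exists_perm_sorted_bool_four F
  -- the reindexed family `A ∘ τ` is hereditary
  have hA' : HereditaryAllOrders μ (fun j => A (τ j)) := by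
    have := hA.comp (fun j : Fin 4 => ({τ j} : Finset (Fin 4)))
    simpa only [Finset.set_biInter_singleton] using this
  have key := bernsteinPos_four_singletons_sorted hμ hμ1 h3 (fun j => A (τ j)) hA' k
  refine key.congr fun h _ _ => ?_
  -- `E_4` of the family in the order `τ` equals `E_4` in the standard order
  have hperm := sahiE_comp_perm (coinWeight μ h) 4 τ (fun i => ind (orCoin (A i) (F i)))
  rw [← hperm]
  congr 1
  funext j
  have := congrFun hk j
  rw [this]

end Singletons

/-! ### The assembly -/

section Assembly

variable {α : Type} [Fintype α] {μ : α → ℝ} (hμ : ∀ a, 0 ≤ μ a) (hμ1 : ∑ a, μ a = 1)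
include hμ hμ1

/-- **H-MIX FOR FOUR EVENTS FROM THE TWO CELLS.**  Assuming GC(3) and the three-of-four cell, every row of the ∩-closed family of the OR-mixed events of a hereditarily
all-orders-positive quadruple is Bernstein-positive of its degree in the bias — for every `F` and every multiset of members. [this work] -/
theorem hereditaryMixture_four_of_cells (hGC : GenericCellThree) (h3 : OrThreeOfFourCell) (A : Fin 4 → Set α) (F : Fin 4 → Bool)
    (hA : HereditaryAllOrders μ A) (m : ℕ) (K : Fin m → Finset (Fin 4)) :
    BernsteinPos m (fun h => sahiE (coinWeight μ h) m (fun j => ind (⋂ i ∈ K j, orCoin (A i) (F i)))) := by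
  refine bernsteinPos_sahiE_of_uncovered hμ hμ1 (fun L : Finset (Fin 4) => ⋂ i ∈ L, orCoin (A i) (F i)) (fun m K hunc => ?_) m K
  have hirr : Irredundant K := Irredundant.of_uncovered _ K hunc
  have hm : m ≤ 4 := hirr.card_le
  -- containments and covariances of members of the ∩-closed family
  have hsub : ∀ L : Finset (Fin 4), (⋂ i ∈ L, A i) ⊆ ⋂ i ∈ L.filter (fun i => F i = false), A i := fun L =>
    Set.biInter_subset_biInter_left (Finset.filter_subset _ L)
  have hcov : ∀ L L' : Finset (Fin 4), 0 ≤ ex μ (ind (⋂ i ∈ L, A i) * ind (⋂ i ∈ L', A i)) - ex μ (ind (⋂ i ∈ L, A i)) * ex μ (ind (⋂ i ∈ L', A i)) := by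
    intro L L'
    have h2 := hA 2 ![L, L']
    rw [sahiE_two_apply] at h2
    simp only [Matrix.cons_val_zero, Matrix.cons_val_one] at h2
    linarith
  interval_cases m
  · exact (bernsteinPos_const 0 le_rfl).congr fun h _ _ => by rw [sahiE_zero]
  · exact (bernsteinPos_ex_coinWeight hμ (fun x => ind_nonneg _ x)).congr fun h _ _ => by rw [sahiE_one_apply]
  · -- two slots: the generic two-slot cell
    have e : (fun j => ind (⋂ i ∈ K j, orCoin (A i) (F i))) =
        ![ind (mixEv (⋂ i ∈ K 0, A i) (⋂ i ∈ (K 0).filter (fun i => F i = false), A i)),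
          ind (mixEv (⋂ i ∈ K 1, A i) (⋂ i ∈ (K 1).filter (fun i => F i = false), A i))] := by
      funext j; fin_cases j <;> simp [biInter_orCoin_eq_mixEv]
    simp only [e]
    exact bernsteinPos_two_mixEv hμ _ _ _ _ (hsub _) (hsub _) (hcov _ _) (hcov _ _)
  · -- three slots: an instance of GC(3)
    have e : (fun j => ind (⋂ i ∈ K j, orCoin (A i) (F i))) =
        ![ind (mixEv (⋂ i ∈ K 0, A i) (⋂ i ∈ (K 0).filter (fun i => F i = false), A i)),
          ind (mixEv (⋂ i ∈ K 1, A i) (⋂ i ∈ (K 1).filter (fun i => F i = false), A i)),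
          ind (mixEv (⋂ i ∈ K 2, A i) (⋂ i ∈ (K 2).filter (fun i => F i = false), A i))] := by
      funext j; fin_cases j <;> simp [biInter_orCoin_eq_mixEv]
    simp only [e]
    refine hGC α μ hμ hμ1 _ _ _ _ _ _ (hsub _) (hsub _) (hsub _) ?_
    have hsix := hA.comp ![K 0, K 1, K 2, (K 0).filter (fun i => F i = false), (K 1).filter (fun i => F i = false), (K 2).filter (fun i => F i = false)]
    refine fun m' K' => ?_
    have := hsix m' K'
    convert this using 4
    rename_i j
    congr 1
    funext l
    fin_cases l <;> rfl
  · -- four slots: singleton index sets, the original cells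
    obtain ⟨σ, hσ⟩ := hirr.exists_perm_singleton
    have e : (fun j => ind (⋂ i ∈ K j, orCoin (A i) (F i))) = fun j => (fun i => ind (orCoin (A i) (F i))) (σ j) := by
      funext j; rw [hσ j, Finset.set_biInter_singleton]
    have key := bernsteinPos_four_singletons hμ hμ1 h3 A hA F
    refine key.congr fun h _ _ => ?_
    rw [e, sahiE_comp_perm (coinWeight μ h) 4 σ (fun i => ind (orCoin (A i) (F i)))]

end Assembly

end SahiMixture

end Summit.CriticalPhenomena.PercolationContinuityZ3.Theorems

end
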